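import Literature.Probability.LatticeModels.MedialCycleTurning

/-!
# Winding numbers of the perturbed polygon of a cycle of the turning rule
(helper for stub `stub_kirchhoff` of line `finitary-green-pairing`, crux `CoherentMorera`, stmt-CriticalPhenomena-11388)

Bookkeeping around the closed perturbed polygon `cyLoop` of a cycle of `nextCorner β`
(`MedialCycleSeparation.lean`), needed for the SIGNED Umlaufsatz behind Duminil-Copin's vertex
relation at spin `1/3`:

* `crossInc_cyPath_eq_sum`, `crossInc_cyLoop_eq_sum`, `crossInc_cyLoop_eq_piece` — the crossing
  defect of the polygon relative to a segment `[ℓ, r]` is the sum of those of its pieces, hence that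
  of its `j₀`-th dart piece when all other pieces miss `[ℓ, r]` (the tree's `crossInc_cyLoop_eq` is
  the case `j₀ = 0`);
* `wind_fst_ne_wind_partner` — the winding numbers of the two endpoints of a closed edge crossed by
  the cycle at ANY of its darts differ, when the partner corner is not on the cycle (the tree's
  `medialCycle_separates_holds` is the case of the first dart, packaged as non-reachability);
* `wind_cyLoop_eq_zero_of_im_ne` — a point at a height the polygon never visits has winding number
  zero; `lt_im_of_mem_range_cyLoop` — the polygon stays above any common strict lower bound of its
  vertices.
-/

noncomputable section

namespace Summit.CriticalPhenomena.CardyFormulaZ2.Cruxes.CoherentMorera.FinitaryGreenPairing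

open Complex Set Literature.Topology.PlaneTopology Literature.Probability.LatticeModels
open Literature.Probability.Percolation (BondConfig)

variable {β : BondConfig (Site 2)} {q : Site 2 × Fin 4}

/-! ### Crossing defects: full additivity over the pieces -/

/-- A point off all dart pieces `≤ k` and all connectors `< k` is off the open polygon `cyPath k`. -/
theorem not_mem_range_cyPath {k : ℕ} {z : ℂ} (hd : ∀ j ≤ k, z ∉ cyDart β q j)
    (hc : ∀ j < k, z ∉ cyConn β q j) : z ∉ range (cyPath β q k) := by
  intro hz
  rcases range_cyPath_subset k hz with h | h
  · obtain ⟨j, hj, h⟩ := mem_iUnion₂.1 h; exact hd j hj h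
  · obtain ⟨j, hj, h⟩ := mem_iUnion₂.1 h; exact hc j hj h

/-- **The crossing defect of the open polygon is the sum of those of its pieces** (darts `0 … k`,
connectors `0 … k-1`), for `ℓ`, `r` off all pieces. -/
theorem crossInc_cyPath_eq_sum {ℓ r : ℂ} : ∀ k : ℕ,
    (∀ j ≤ k, ℓ ∉ cyDart β q j) → (∀ j < k, ℓ ∉ cyConn β q j) →
    (∀ j ≤ k, r ∉ cyDart β q j) → (∀ j < k, r ∉ cyConn β q j) →
      (cyPath β q k).crossInc ℓ r =
        ∑ j ∈ Finset.range (k + 1), (Path.segment (cyS β q j) (cyT β q j)).crossInc ℓ r +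
          ∑ j ∈ Finset.range k, (Path.segment (cyT β q j) (cyS β q (j + 1))).crossInc ℓ r
  | 0 => by
    intro _ _ _ _
    simp [cyPath]
  | k + 1 => by
    intro hℓd hℓc hrd hrc
    have ih := crossInc_cyPath_eq_sum k (fun j hj => hℓd j (by omega)) (fun j hj => hℓc j (by omega))
      (fun j hj => hrd j (by omega)) (fun j hj => hrc j (by omega))
    have hℓ1 : ℓ ∉ range (cyPath β q k) :=
      not_mem_range_cyPath (fun j hj => hℓd j (by omega)) (fun j hj => hℓc j (by omega))
    have hr1 : r ∉ range (cyPath β q k) :=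
      not_mem_range_cyPath (fun j hj => hrd j (by omega)) (fun j hj => hrc j (by omega))
    have hℓ2 : ℓ ∉ range (Path.segment (cyT β q k) (cyS β q (k + 1))) := by
      rw [Path.range_segment]; exact hℓc k (by omega)
    have hr2 : r ∉ range (Path.segment (cyT β q k) (cyS β q (k + 1))) := by
      rw [Path.range_segment]; exact hrc k (by omega)
    have hℓ3 : ℓ ∉ range (Path.segment (cyS β q (k + 1)) (cyT β q (k + 1))) := by
      rw [Path.range_segment]; exact hℓd (k + 1) le_rfl
    have hr3 : r ∉ range (Path.segment (cyS β q (k + 1)) (cyT β q (k + 1))) := by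
      rw [Path.range_segment]; exact hrd (k + 1) le_rfl
    rw [cyPath, Path.crossInc_trans _ _ hℓ1 (by rw [Path.trans_range]; rintro (h | h); exacts [hℓ2 h, hℓ3 h])
      hr1 (by rw [Path.trans_range]; rintro (h | h); exacts [hr2 h, hr3 h]),
      Path.crossInc_trans _ _ hℓ2 hℓ3 hr2 hr3, ih,
      Finset.sum_range_succ (fun j => (Path.segment (cyS β q j) (cyT β q j)).crossInc ℓ r) (k + 1),
      Finset.sum_range_succ (fun j => (Path.segment (cyT β q j) (cyS β q (j + 1))).crossInc ℓ r) k]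
    ring

/-- **The crossing defect of the closed polygon is the sum of those of its `n + 1` dart pieces
and `n + 1` connectors**, for `ℓ`, `r` off all pieces. -/
theorem crossInc_cyLoop_eq_sum {ℓ r : ℂ} (n : ℕ) (h : cornerOrbit β q (n + 1) = q)
    (hℓd : ∀ j ≤ n, ℓ ∉ cyDart β q j) (hℓc : ∀ j ≤ n, ℓ ∉ cyConn β q j)
    (hrd : ∀ j ≤ n, r ∉ cyDart β q j) (hrc : ∀ j ≤ n, r ∉ cyConn β q j) :
    (cyLoop n h).crossInc ℓ r =
      ∑ j ∈ Finset.range (n + 1), (Path.segment (cyS β q j) (cyT β q j)).crossInc ℓ r +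
        ∑ j ∈ Finset.range (n + 1), (Path.segment (cyT β q j) (cyS β q (j + 1))).crossInc ℓ r := by
  have hℓ1 : ℓ ∉ range (cyPath β q n) := not_mem_range_cyPath hℓd (fun j hj => hℓc j hj.le)
  have hr1 : r ∉ range (cyPath β q n) := not_mem_range_cyPath hrd (fun j hj => hrc j hj.le)
  have hℓ2 : ℓ ∉ range (Path.segment (cyT β q n) (cyS β q (n + 1))) := by
    rw [Path.range_segment]; exact hℓc n le_rfl
  have hr2 : r ∉ range (Path.segment (cyT β q n) (cyS β q (n + 1))) := by
    rw [Path.range_segment]; exact hrc n le_rfl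
  rw [cyLoop, Path.crossInc_cast, Path.crossInc_trans _ _ hℓ1 hℓ2 hr1 hr2,
    crossInc_cyPath_eq_sum n hℓd (fun j hj => hℓc j hj.le) hrd (fun j hj => hrc j hj.le),
    Finset.sum_range_succ (fun j => (Path.segment (cyT β q j) (cyS β q (j + 1))).crossInc ℓ r) n]
  ring

/-- **The crossing defect of the closed polygon is that of its `j₀`-th dart piece**, when all
other dart pieces and all connectors miss `[ℓ, r]` (generalises the tree's `crossInc_cyLoop_eq`,
`j₀ = 0`). -/
theorem crossInc_cyLoop_eq_piece {ℓ r : ℂ} (n : ℕ) (h : cornerOrbit β q (n + 1) = q) {j₀ : ℕ}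
    (hj₀ : j₀ ≤ n) (hd : ∀ j ≤ n, j ≠ j₀ → ∀ z ∈ cyDart β q j, z ∉ segment ℝ ℓ r)
    (hc : ∀ j ≤ n, ∀ z ∈ cyConn β q j, z ∉ segment ℝ ℓ r)
    (hℓ : ℓ ∉ cyDart β q j₀) (hr : r ∉ cyDart β q j₀) :
    (cyLoop n h).crossInc ℓ r = (Path.segment (cyS β q j₀) (cyT β q j₀)).crossInc ℓ r := by
  have hℓd : ∀ j ≤ n, ℓ ∉ cyDart β q j := fun j hj hz => by
    by_cases hjj : j = j₀
    · subst hjj; exact hℓ hz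
    · exact hd j hj hjj ℓ hz (left_mem_segment _ _ _)
  have hrd : ∀ j ≤ n, r ∉ cyDart β q j := fun j hj hz => by
    by_cases hjj : j = j₀
    · subst hjj; exact hr hz
    · exact hd j hj hjj r hz (right_mem_segment _ _ _)
  have hℓc : ∀ j ≤ n, ℓ ∉ cyConn β q j := fun j hj hz => hc j hj ℓ hz (left_mem_segment _ _ _)
  have hrc : ∀ j ≤ n, r ∉ cyConn β q j := fun j hj hz => hc j hj r hz (right_mem_segment _ _ _)
  rw [crossInc_cyLoop_eq_sum n h hℓd hℓc hrd hrc]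
  have hconn : ∑ j ∈ Finset.range (n + 1), (Path.segment (cyT β q j) (cyS β q (j + 1))).crossInc ℓ r = 0 := by
    refine Finset.sum_eq_zero fun j hj => ?_
    rw [Finset.mem_range] at hj
    exact Path.crossInc_eq_zero _ fun t => hc j (by omega) _ (segment_apply_mem _ _ t)
  rw [hconn, add_zero, Finset.sum_eq_single j₀]
  · intro j hj hjj
    rw [Finset.mem_range] at hj
    exact Path.crossInc_eq_zero _ fun t => hd j (by omega) hjj _ (segment_apply_mem _ _ t)
  · intro hj; exact absurd (Finset.mem_range.2 (by omega)) hj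

/-! ### The winding number jumps across a crossed closed edge, at any dart of the cycle -/

/-- **Jump across a crossed edge.** Let the cycle of minimal period `n + 1` through `q` cross the
closed edge `cTgt r` at its `j₀`-th dart `r = orb j₀`, and let the partner corner of `r` (the
other corner arriving at that edge) not lie on the cycle.  Then the vertex of `r` and the vertex of
the partner (the two endpoints of the crossed edge) have different winding numbers with respect to
the closed perturbed polygon. -/
theorem wind_fst_ne_wind_partner {n : ℕ} (hP : cornerOrbit β q (n + 1) = q)
    (hmin : ∀ s, 0 < s → s < n + 1 → cornerOrbit β q s ≠ q) {j₀ : ℕ} (hj₀ : j₀ ≤ n)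
    (he : cTgt (cornerOrbit β q j₀) ∉ β) (hL : ∀ m, cornerOrbit β q m ≠ cornerPartner (cornerOrbit β q j₀)) :
    wind (fun t => (cyLoop n hP).extend t - Site.toComplex (cornerOrbit β q j₀).1) ≠
      wind (fun t => (cyLoop n hP).extend t - Site.toComplex (cornerPartner (cornerOrbit β q j₀)).1) := by
  classical
  set r := cornerOrbit β q j₀ with hrdef
  set p := cornerPartner r with hpdef
  have hpr : cornerPartner p = r := partner_partner r
  have hep : cTgt p ∉ β := by rwa [hpdef, cTgt_partner]
  -- the common face of the two arriving corners, seen from `r.1` and from `p.1`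
  have hfx : cFace r = faceAt p.1 (p.2 + 1) := by
    have h1 : r.1 = p.1 + cornerUnit (p.2 + 1) := by rw [← hpr]; rfl
    have h2 : r.2 = (p.2 + 1) + 1 := by
      rw [← hpr, cornerPartner]; simp only; omega
    rw [cFace, h1, h2, faceAt_add_unit_succ]
  set γ := cyLoop (β := β) (q := q) n hP with hγ
  set ℓ := Site.toComplex r.1 with hℓ
  set rc := faceCenter (cFace r) with hrc
  -- (A) one transversal crossing of `[ℓ, rc]`: by the `j₀`-th dart piece only
  have hhalf : halfDiag r.1 (faceAt r.1 r.2) = segment ℝ ℓ rc := rfl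
  have hd : ∀ j ≤ n, j ≠ j₀ → ∀ z ∈ cyDart β q j, z ∉ segment ℝ ℓ rc := by
    intro j hjn hjj z hz hz'
    rw [← hhalf] at hz'
    have hj := cy_eq_of_mem_halfDiag j hz hz'
    exact hjj (orb_injOn hmin (by omega) (by omega) (hj.trans (Prod.ext rfl rfl)))
  have hc : ∀ j ≤ n, ∀ z ∈ cyConn β q j, z ∉ segment ℝ ℓ rc := by
    intro j _ z hz hz'
    rw [← hhalf] at hz'
    exact cyConn_disjoint_halfDiag j (isCorner_faceAt r.1 r.2) hz hz'
  have hℓγ : ℓ ∉ range γ := not_mem_range_cyLoop hP (fun j _ => toComplex_not_mem_cyDart _ _)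
    (fun j _ => toComplex_not_mem_cyConn _ _)
  have hrγ : rc ∉ range γ := not_mem_range_cyLoop hP (fun j _ => faceCenter_not_mem_cyDart _ _)
    (fun j _ => faceCenter_not_mem_cyConn _ _)
  have hcross : γ.crossInc ℓ rc ≠ 0 := by
    rw [hγ, crossInc_cyLoop_eq_piece n hP hj₀ hd hc (toComplex_not_mem_cyDart _ _) (faceCenter_not_mem_cyDart _ _)]
    have key := crossInc_dartSeg_ne_zero (isCorner_faceAt r.1 r.2)
    have h01 : ∀ v f : Site 2, (srcDir v f = 0 ∧ tgtDir v f = 1) ∨ (srcDir v f = 1 ∧ tgtDir v f = 0) := by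
      intro v f; unfold srcDir tgtDir; split_ifs <;> simp
    rcases h01 (cyV β q j₀) (cyF β q j₀) with ⟨h0, h1⟩ | ⟨h0, h1⟩
    · rw [cyS, cyT, h0, h1]; exact key
    · rw [cyS, cyT, h0, h1, ← Path.segment_symm, Path.crossInc_symm]
      · exact neg_ne_zero.2 key
      · rw [Path.range_segment]; exact fun h' => toComplex_not_mem_dartSeg (isCorner_faceAt r.1 r.2) h'
      · rw [Path.range_segment]; exact fun h' => faceCenter_not_mem_dartSeg (isCorner_faceAt r.1 r.2) h'
  have hA : wind (fun t => γ.extend t - ℓ) ≠ wind (fun t => γ.extend t - rc) := by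
    intro hw
    rw [Path.crossInc_loop γ hℓγ hrγ, hw, sub_self, zero_mul] at hcross
    exact hcross rfl
  -- (B) no crossing of `[p.1, rc]`: the only candidate dart is the successor of `p`
  have hsucc : nextCorner β p = (p.1, p.2 + 1) := nextCorner_of_not_mem hep
  have hB : wind (fun t => γ.extend t - Site.toComplex p.1) = wind (fun t => γ.extend t - rc) := by
    refine wind_cyLoop_eq_of_segment hP fun z hz => not_mem_range_cyLoop hP (fun j _ hzj => ?_) (fun j _ hzj => ?_)
    · have hz' : z ∈ halfDiag p.1 (faceAt p.1 (p.2 + 1)) := by rw [halfDiag, ← hfx]; exact hz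
      have hj := cy_eq_of_mem_halfDiag j hzj hz'
      have hper : cornerOrbit β q (j + n + 1) = cornerOrbit β q j := by
        rw [add_assoc]; exact cornerOrbit_add_period hP j
      have : nextCorner β (cornerOrbit β q (j + n)) = nextCorner β p := by
        rw [hsucc, ← hj, ← hper]; rfl
      exact hL (j + n) (nextCorner_injective this)
    · have hz' : z ∈ halfDiag p.1 (faceAt p.1 (p.2 + 1)) := by rw [halfDiag, ← hfx]; exact hz
      exact cyConn_disjoint_halfDiag j (isCorner_faceAt p.1 (p.2 + 1)) hzj hz'
  intro hw
  exact hA (hw.trans hB)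

/-! ### Heights: points below (or above) the whole polygon -/

/-- **A point at a height the polygon never visits has winding number zero**: `z ↦ z - a` has a
continuous logarithm (the principal one) off the horizontal line through `a`. -/
theorem wind_cyLoop_eq_zero_of_im_ne {n : ℕ} (h : cornerOrbit β q (n + 1) = q) {a : ℂ}
    (ha : ∀ z ∈ range (cyLoop n h), z.im ≠ a.im) :
    wind (fun t => (cyLoop n h).extend t - a) = 0 := by
  set γ := cyLoop (β := β) (q := q) n h
  have hF : HasLogOn (fun z : ℂ => z - a) {z : ℂ | z.im ≠ a.im} := by
    refine ⟨fun z => log (z - a), ?_, fun z hz => exp_log ?_⟩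
    · refine ContinuousOn.clog (by fun_prop) fun z hz => ?_
      rw [mem_slitPlane_iff]
      exact Or.inr (by simpa [sub_eq_zero] using hz)
    · intro h0
      have : (z - a).im = 0 := by rw [h0]; rfl
      exact hz (by simpa [sub_eq_zero] using this)
  have hcomp : (fun t => γ.extend t - a) = (fun z : ℂ => z - a) ∘ γ.extend := rfl
  rw [hcomp]
  refine wind_comp_eq_zero_of_hasLogOn hF γ.continuous_extend.continuousOn (fun t ht => ?_) ?_
  · exact ha _ (by rw [γ.extend_apply ht]; exact mem_range_self _)
  · rw [γ.extend_zero, γ.extend_one]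

/-- A point of a segment is at least as high as the lower of its endpoints (strict form). -/
theorem lt_im_of_mem_segment {A B z : ℂ} {b : ℝ} (hA : b < A.im) (hB : b < B.im)
    (hz : z ∈ segment ℝ A B) : b < z.im := by
  obtain ⟨s, t, hs, ht, hst, rfl⟩ := hz
  simp only [add_im, smul_im, smul_eq_mul]
  rcases hs.eq_or_lt with rfl | hs'
  · rw [zero_add] at hst; subst hst; simpa using hB
  · have h1 : s * b < s * A.im := mul_lt_mul_of_pos_left hA hs'
    have h2 : t * b ≤ t * B.im := mul_le_mul_of_nonneg_left hB.le ht
    have h3 : s * b + t * b = b := by rw [← add_mul, hst, one_mul]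
    linarith

/-- **The polygon stays strictly above any common strict lower bound of its vertices.** -/
theorem lt_im_of_mem_range_cyLoop {n : ℕ} (h : cornerOrbit β q (n + 1) = q) {b : ℝ}
    (hS : ∀ j ≤ n + 1, b < (cyS β q j).im) (hT : ∀ j ≤ n, b < (cyT β q j).im)
    {z : ℂ} (hz : z ∈ range (cyLoop n h)) : b < z.im := by
  rcases range_cyLoop_subset n h hz with h' | h'
  · obtain ⟨j, hj, h'⟩ := mem_iUnion₂.1 h'
    exact lt_im_of_mem_segment (hS j (by omega)) (hT j hj) h'
  · obtain ⟨j, hj, h'⟩ := mem_iUnion₂.1 h'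
    exact lt_im_of_mem_segment (hT j hj) (hS (j + 1) (by omega)) h'

/-- **The polygon stays strictly below any common strict upper bound of its vertices.** -/
theorem im_lt_of_mem_range_cyLoop {n : ℕ} (h : cornerOrbit β q (n + 1) = q) {b : ℝ}
    (hS : ∀ j ≤ n + 1, (cyS β q j).im < b) (hT : ∀ j ≤ n, (cyT β q j).im < b)
    {z : ℂ} (hz : z ∈ range (cyLoop n h)) : z.im < b := by
  have key : ∀ {A B w : ℂ}, A.im < b → B.im < b → w ∈ segment ℝ A B → w.im < b := by
    intro A B w hA hB hw
    obtain ⟨s, t, hs, ht, hst, rfl⟩ := hw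
    simp only [add_im, smul_im, smul_eq_mul]
    rcases hs.eq_or_lt with rfl | hs'
    · rw [zero_add] at hst; subst hst; simpa using hB
    · have h1 : s * A.im < s * b := mul_lt_mul_of_pos_left hA hs'
      have h2 : t * B.im ≤ t * b := mul_le_mul_of_nonneg_left hB.le ht
      have h3 : s * b + t * b = b := by rw [← add_mul, hst, one_mul]
      linarith
  rcases range_cyLoop_subset n h hz with h' | h'
  · obtain ⟨j, hj, h'⟩ := mem_iUnion₂.1 h'
    exact key (hS j (by omega)) (hT j hj) h'
  · obtain ⟨j, hj, h'⟩ := mem_iUnion₂.1 h'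
    exact key (hT j hj) (hS (j + 1) (by omega)) h'

/-- **Jump across a crossed edge, registered form** (glue sub-goal `cycleWinding_jump` of the line):
for a cycle of minimal period `n + 1` through `q` crossing the closed edge `cTgt (orb j₀)` at its
`j₀`-th dart, with the partner corner off the cycle, the two endpoints of that edge have different
winding numbers with respect to the closed perturbed polygon. -/
theorem cycleWinding_jump : ∀ (β : BondConfig (Site 2)) (q : Site 2 × Fin 4) (n : ℕ)
    (hP : cornerOrbit β q (n + 1) = q), (∀ s, 0 < s → s < n + 1 → cornerOrbit β q s ≠ q) →
    ∀ (j₀ : ℕ), j₀ ≤ n → cTgt (cornerOrbit β q j₀) ∉ β →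
    (∀ m, cornerOrbit β q m ≠ cornerPartner (cornerOrbit β q j₀)) →
    wind (fun t => (cyLoop n hP).extend t - Site.toComplex (cornerOrbit β q j₀).1) ≠
      wind (fun t => (cyLoop n hP).extend t - Site.toComplex (cornerPartner (cornerOrbit β q j₀)).1) :=
  fun _ _ _ hP hmin _ hj₀ he hL => wind_fst_ne_wind_partner hP hmin hj₀ he hL

end Summit.CriticalPhenomena.CardyFormulaZ2.Cruxes.CoherentMorera.FinitaryGreenPairing

end
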